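import Summits.HodgeConjecture.CorCM.Census.CentralSquaresMixedFaceCorners
import Summits.HodgeConjecture.CorCM.Census.CentralSquaresCyclicChain
import Summits.HodgeConjecture.CorCM.Census.CentralSquaresOrderFourFrame

/-!
# The square-central class, XLIII: the FIBRE CONGRUENCES of the mixed-face frame, and strict triples at orbit corners

COR-CM (cell `pub-hodgecm2`), count-neutral kernel combinatorics by the binder seat b09 (gen 48; lane SQUARE-CENTRAL CLASS, part XLIII), on part XLI
(`defect_T₁_mixed_face'`, `Y_sub_Y'_mem_of_mixed_face'`), part XXVIII (`mapDomain_rt_Y_of_swap`, `mapDomain_rt_Y'_of_swap`, `mapDomain_rt_Y[']_of_stab_stab`),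
part XXVII (`thetaG_typeSum_oflipCM_of_not_mem`) and part XXXIV (`bpot_orbit_corner`, `unique_T₀_below_orbit_corner`) BY NAME.  Theorems only: no definition,
no `decide`, no certificate, no named fact, no `sorry`.  HONEST FRAMING: `HC_CM` is NOT proved, here or anywhere in the tree; nothing here is a period or a
headline.

THE DIHEDRAL ROWS, ALL KERNELS (design note `CYCLIC-KERNEL.md`, gen 48; numerics: in all 246 frames of order 16/32 checked, the mixed face closes the residual
lattice with Smith `[m, 2m]` once ALL of `Stab Φ = ker π ∪ π⁻¹(sr)` is used; a single reflection lift `g₁` suffices exactly when `⟨g₁²⟩ = ker π`).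
Base-involutive frame `(T₀; T₁, Q)`, `T ⊆ 𝓗` and `A ⊆ 𝓗ᶜ` transversals of the swap (`|T| = |A| = m`), `Φ = {T ∣ A}` with its mixed face at `k ∈ A`,
`h ∈ 𝓗 ∖ T` and the two prescribed tie faces (part XLI); `g₁ ∈ Stab T₀ ∩ Stab Φ` with `T₁·g₁⁻¹ = T̄₁` (a lift of `sr`), and KERNEL MOVERS
`u ∈ Stab T₀ ∩ Stab T₁ ∩ Stab Φ` (in the rows: the elements of `ker π`).

* §1 `strict_triple_orbit_corner`: at an orbit corner `{T ∣ B}` (`|T| = m`, `|B| < m`) the triple toward `T₀` at two places of `T` is STRICT (all three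
  corners have `T₀` as unique nearest base change, part XXXIV §1) — the admissibility input for the two prescribed tie blocks of the frame law (part XLIV).
* §2 **`Y_sub_Y_mem_of_kernel_mover`**: `Y_h − Y_{h·u⁻¹} ∈ L` for a kernel mover `u` — the `T₁`-defect of `Φ` (part XLI §1) minus its `u`-translate, in
  coordinates; **`Y'_sub_Y_mem_of_kernel_mover`**: `Y'_{h·g₁⁻¹·u⁻¹} − Y_h ∈ L` (the `u`-translate of part XLIʼs `W = Y_h − Y'_{h·g₁⁻¹}`).
* §3 **`fibre_congruences`**: if every place of `𝓗 ∖ T` is `h·u⁻¹` and every place of `𝓗ᶜ ∖ A` is `h·g₁⁻¹·u⁻¹` for kernel movers `u` (in the rows: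
  `ker π` is transitive on its cosets), then `Y_x ≡ Y_h` on `𝓗 ∖ T`, `Y'_y ≡ Y_h` on `𝓗ᶜ ∖ A`, and — along the swap — `Y_x ≡ Y_{h·Q⁻¹}` on `T`,
  `Y'_y ≡ −Y_{h·Q⁻¹}` on `A`: exactly the hypotheses of part XLIIʼs `residual_closure_cyclic` (closure up to `2m`).

## References
* [Pohlmann1968] H. Pohlmann, Algebraic cycles on abelian varieties of complex multiplication type, Ann. of Math. 88 (1968), Thm 1.
-/
namespace Summit.HodgeConjecture.CorCM.Census.CentralSquares

open Finset
open scoped symmDiff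
open Summit.HodgeConjecture.CorCM.Prior.AllgGroup.RfwfAllgGroup
open Summit.HodgeConjecture.CorCM.Census.BlockParity
open Summit.HodgeConjecture.CorCM.Census.Coinvariant
open Summit.HodgeConjecture.CorCM.Census.TwistGeneration
open Summit.HodgeConjecture.CorCM.Census.BaseBlock
open Summit.HodgeConjecture.CorCM.Census.CoverClosure

noncomputable section

variable {G : Type*} [Group G] [Fintype G] [DecidableEq G] (c : G)

section Frame

variable (hc2 : c * c = 1) (hcen : ∀ x : G, x * c = c * x) (T₀ T₁ : CMF G c)
variable (hbase : ∀ Q : G, rt c Q T₀ = T₀ ∨ rt c Q T₀ = rt c c T₀ ∨ rt c Q T₀ = T₁ ∨ rt c Q T₀ = rt c c T₁)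
variable (m : ℕ) (hn : T₀.1.card = 4 * m) (hH : (T₀.1 \ T₁.1).card = 2 * m)

/-! ## §1 Strict triples at orbit corners -/

include hc2 hcen hbase hn hH in
/-- **THE TRIPLE TOWARD `T₀` AT AN ORBIT CORNER IS STRICT.**  `X = {T ∣ B}` with `T ⊆ 𝓗`, `|T| = m`, `B ⊆ 𝓗ᶜ`, `|B| < m`; for two distinct places
`s, s' ∈ T` the lowering triple `(1; s, s')` at `X` is strict: `bpot X = ddist T₀ X` and the corners `X^{(s)}`, `X^{(s')}`, `X^{(s)(s')}` have `T₀` as their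
unique nearest base change (part XXXIV `unique_T₀_below_orbit_corner`). [folklore] -/
theorem strict_triple_orbit_corner (T B : Finset G) (hTH : T ⊆ T₀.1 \ T₁.1) (hTm : T.card = m)
    (hB : B ⊆ T₀.1 \ (T₀.1 \ T₁.1)) (hBm : B.card < m) (X : CMF G c) (hX : T₀.1 \ X.1 = T ∪ B)
    {s s' : G} (hs : s ∈ T) (hs' : s' ∈ T) (hss' : s ≠ s') :
    bpot c T₀ X = ddist (rt c (1 : G) T₀) X ∧ s ∈ (rt c (1 : G) T₀).1 \ X.1 ∧ s' ∈ (rt c (1 : G) T₀).1 \ X.1 ∧ s ≠ s' ∧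
      (∀ Q' : G, ddist (rt c Q' T₀) (oflipCM c hc2 s X) = bpot c T₀ (oflipCM c hc2 s X) → rt c Q' T₀ = rt c (1 : G) T₀) ∧
      (∀ Q' : G, ddist (rt c Q' T₀) (oflipCM c hc2 s' X) = bpot c T₀ (oflipCM c hc2 s' X) → rt c Q' T₀ = rt c (1 : G) T₀) ∧
      (∀ Q' : G, ddist (rt c Q' T₀) (oflipCM c hc2 s (oflipCM c hc2 s' X)) = bpot c T₀ (oflipCM c hc2 s (oflipCM c hc2 s' X)) →
        rt c Q' T₀ = rt c (1 : G) T₀) := by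
  obtain ⟨hbp, hcard, -⟩ := bpot_orbit_corner c hc2 hcen T₀ T₁ hbase m hn hH T B hTH hTm hB hBm X hX
  have hsD : s ∈ T₀.1 \ X.1 := by rw [hX]; exact mem_union_left _ hs
  have hs'D : s' ∈ T₀.1 \ X.1 := by rw [hX]; exact mem_union_left _ hs'
  have hDs : T₀.1 \ (oflipCM c hc2 s X).1 = (T ∪ B).erase s := by rw [dev_oflip c hc2 (mem_sdiff.mp hsD).1 (mem_sdiff.mp hsD).2, hX]
  have hDs' : T₀.1 \ (oflipCM c hc2 s' X).1 = (T ∪ B).erase s' := by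
    rw [dev_oflip c hc2 (mem_sdiff.mp hs'D).1 (mem_sdiff.mp hs'D).2, hX]
  have hsDs' : s ∈ T₀.1 \ (oflipCM c hc2 s' X).1 := by rw [hDs']; exact mem_erase.mpr ⟨hss', mem_union_left _ hs⟩
  have hDss' : T₀.1 \ (oflipCM c hc2 s (oflipCM c hc2 s' X)).1 = ((T ∪ B).erase s').erase s := by
    rw [dev_oflip c hc2 (mem_sdiff.mp hsDs').1 (mem_sdiff.mp hsDs').2, hDs']
  have hu1 := (unique_T₀_below_orbit_corner c hc2 hcen T₀ T₁ hbase m hn hH T B hTH hTm hB hBm (oflipCM c hc2 s X)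
    (by rw [hDs]; exact erase_subset _ _) (fun h' => (notMem_erase s _) (hDs ▸ h' hs))).2
  have hu2 := (unique_T₀_below_orbit_corner c hc2 hcen T₀ T₁ hbase m hn hH T B hTH hTm hB hBm (oflipCM c hc2 s' X)
    (by rw [hDs']; exact erase_subset _ _) (fun h' => (notMem_erase s' _) (hDs' ▸ h' hs'))).2
  have hu3 := (unique_T₀_below_orbit_corner c hc2 hcen T₀ T₁ hbase m hn hH T B hTH hTm hB hBm (oflipCM c hc2 s (oflipCM c hc2 s' X))
    (by rw [hDss']; exact (erase_subset _ _).trans (erase_subset _ _))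
    (fun h' => (notMem_erase s _) (hDss' ▸ h' hs))).2
  refine ⟨?_, ?_, ?_, hss', hu1, hu2, hu3⟩
  · rw [rt_one, hbp]; show m + B.card = (T₀.1 \ X.1).card; rw [hcard]
  · rw [rt_one]; exact hsD
  · rw [rt_one]; exact hs'D

/-! ## §2 Kernel movers: `Y_h − Y_{h·u⁻¹} ∈ L` and `Y'_{h·g₁⁻¹·u⁻¹} − Y_h ∈ L` -/

variable (Q : G) (hQ : rt c Q T₀ = T₁)
variable (L : Submodule ℤ (CMF G c →₀ ℤ)) (hLrt : ∀ (Q' : G) (y : CMF G c →₀ ℤ), y ∈ L → Finsupp.mapDomain (rt c Q') y ∈ L)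
variable (hcover : ∀ Ψ : CMF G c, 2 ≤ bpot c T₀ Ψ → ∃ Q₂ s s' : G, bpot c T₀ Ψ = ddist (rt c Q₂ T₀) Ψ ∧
    s ∈ (rt c Q₂ T₀).1 \ Ψ.1 ∧ s' ∈ (rt c Q₂ T₀).1 \ Ψ.1 ∧ s ≠ s' ∧
    gface c hc2 Ψ s s' ∈ L ∧
    ((∃ Q₁ t t' : G, bpot c T₀ Ψ = ddist (rt c Q₁ T₀) Ψ ∧ t ∈ (rt c Q₁ T₀).1 \ Ψ.1 ∧ t' ∈ (rt c Q₁ T₀).1 \ Ψ.1 ∧ t ≠ t' ∧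
        (∀ Q' : G, ddist (rt c Q' T₀) (oflipCM c hc2 t Ψ) = bpot c T₀ (oflipCM c hc2 t Ψ) → rt c Q' T₀ = rt c Q₁ T₀) ∧
        (∀ Q' : G, ddist (rt c Q' T₀) (oflipCM c hc2 t' Ψ) = bpot c T₀ (oflipCM c hc2 t' Ψ) → rt c Q' T₀ = rt c Q₁ T₀) ∧
        (∀ Q' : G, ddist (rt c Q' T₀) (oflipCM c hc2 t (oflipCM c hc2 t' Ψ)) = bpot c T₀ (oflipCM c hc2 t (oflipCM c hc2 t' Ψ)) →
          rt c Q' T₀ = rt c Q₁ T₀)) →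
      (∀ Q' : G, ddist (rt c Q' T₀) (oflipCM c hc2 s Ψ) = bpot c T₀ (oflipCM c hc2 s Ψ) → rt c Q' T₀ = rt c Q₂ T₀) ∧
      (∀ Q' : G, ddist (rt c Q' T₀) (oflipCM c hc2 s' Ψ) = bpot c T₀ (oflipCM c hc2 s' Ψ) → rt c Q' T₀ = rt c Q₂ T₀) ∧
      (∀ Q' : G, ddist (rt c Q' T₀) (oflipCM c hc2 s (oflipCM c hc2 s' Ψ)) = bpot c T₀ (oflipCM c hc2 s (oflipCM c hc2 s' Ψ)) →
        rt c Q' T₀ = rt c Q₂ T₀)))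
variable (hP : ∀ Ψ : CMF G c, pair c Ψ ∈ L)

include hcen hbase hn hH hQ hLrt hcover hP in
/-- **`Y_h − Y_{h·u⁻¹} ∈ L` FOR A KERNEL MOVER `u`** (`T₀·u⁻¹ = T₀`, `T₁·u⁻¹ = T₁`, `Φ·u⁻¹ = Φ`; pairs in `L`): the `T₁`-defect of the designated type
(part XLI `defect_T₁_mixed_face'`) minus its `u`-translate, in coordinates (both flips at places of `Φ` outside `D(Φ)`). [folklore] -/
theorem Y_sub_Y_mem_of_kernel_mover (hm : 2 ≤ m) (T A : Finset G) (hTH : T ⊆ T₀.1 \ T₁.1) (hTm : T.card = m)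
    (hA : A ⊆ T₀.1 ∩ T₁.1) (hAm : A.card = m) (Φ : CMF G c) (hΦ : T₀.1 \ Φ.1 = T ∪ A)
    {k h : G} (hk : k ∈ A) (hh : h ∈ (T₀.1 \ T₁.1) \ T) (hF : gface c hc2 Φ k h ∈ L)
    {h₁ h₂ : G} (hh₁ : h₁ ∈ (T₀.1 \ T₁.1) \ T) (hh₂ : h₂ ∈ (T₀.1 \ T₁.1) \ T) (h₁₂ : h₁ ≠ h₂)
    (hFk : gface c hc2 (oflipCM c hc2 k Φ) h₁ h₂ ∈ L)
    {k₁ k₂ : G} (hk₁ : k₁ ∈ (T₀.1 ∩ T₁.1) \ A) (hk₂ : k₂ ∈ (T₀.1 ∩ T₁.1) \ A) (hk₁₂ : k₁ ≠ k₂)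
    (hFh : gface c hc2 (oflipCM c hc2 h Φ) k₁ k₂ ∈ L)
    (u : G) (hu₀ : rt c u T₀ = T₀) (hu₁ : rt c u T₁ = T₁) (huΦ : rt c u Φ = Φ) :
    ((Finsupp.single (oflipCM c hc2 h T₀) (1 : ℤ) - Finsupp.single T₀ 1) + (Finsupp.single (oflipCM c hc2 h T₁) (1 : ℤ) - Finsupp.single T₁ 1)) - ((Finsupp.single (oflipCM c hc2 (h * u⁻¹) T₀) (1 : ℤ) - Finsupp.single T₀ 1) + (Finsupp.single (oflipCM c hc2 (h * u⁻¹) T₁) (1 : ℤ) - Finsupp.single T₁ 1)) ∈ L := by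
  have hv := defect_T₁_mixed_face' c hc2 hcen T₀ T₁ hbase m hn hH Q hQ L hLrt hcover hm T A hTH hTm hA hAm Φ hΦ hk hh hF hh₁ hh₂ h₁₂ hFk
    hk₁ hk₂ hk₁₂ hFh
  -- the places
  have hh0 : h ∈ T₀.1 := (mem_sdiff.mp (mem_sdiff.mp hh).1).1
  have hh1 : h ∉ T₁.1 := (mem_sdiff.mp (mem_sdiff.mp hh).1).2
  have hhΦ : h ∈ Φ.1 := by
    by_contra hc'
    have h0 : h ∈ T₀.1 \ Φ.1 := mem_sdiff.mpr ⟨hh0, hc'⟩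
    rw [hΦ, mem_union] at h0
    rcases h0 with hT | hAm'
    · exact (mem_sdiff.mp hh).2 hT
    · exact hh1 (mem_inter.mp (hA hAm')).2
  have hch1 : c * h ∈ T₁.1 := by by_contra hc'; exact hh1 ((T₁.2 h).mpr hc')
  have hch0 : c * h ∉ T₀.1 := (T₀.2 h).mp hh0
  have hchΦ : c * h ∉ Φ.1 := (Φ.2 h).mp hhΦ
  have hch0c : c * h ∈ (rt c c T₀).1 := (mem_compl_type_iff c hcen T₀ (c * h)).mpr hch0
  have hη0 : h * u⁻¹ ∈ T₀.1 := by
    have e : h * u⁻¹ ∈ (rt c u T₀).1 := by rw [mem_rt, inv_mul_cancel_right]; exact hh0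
    rwa [hu₀] at e
  have hηΦ : h * u⁻¹ ∈ Φ.1 := by
    have e : h * u⁻¹ ∈ (rt c u Φ).1 := by rw [mem_rt, inv_mul_cancel_right]; exact hhΦ
    rwa [huΦ] at e
  have hη1 : h * u⁻¹ ∉ T₁.1 := by
    intro h'
    have e : h * u⁻¹ ∈ (rt c u T₁).1 := by rw [hu₁]; exact h'
    rw [mem_rt, inv_mul_cancel_right] at e
    exact hh1 e
  have hcη1 : c * (h * u⁻¹) ∈ T₁.1 := by by_contra hc'; exact hη1 ((T₁.2 _).mpr hc')
  have hcη0 : c * (h * u⁻¹) ∉ T₀.1 := (T₀.2 _).mp hη0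
  have hcηΦ : c * (h * u⁻¹) ∉ Φ.1 := (Φ.2 _).mp hηΦ
  have hcη0c : c * (h * u⁻¹) ∈ (rt c c T₀).1 := (mem_compl_type_iff c hcen T₀ _).mpr hcη0
  -- the `u`-translate of the defect and the difference
  have huc : rt c u (rt c c T₀) = rt c c T₀ := by rw [← rt_mul, hcen u, rt_mul, hu₀]
  have hw := hLrt u _ hv
  simp only [Finsupp.mapDomain_sub, Finsupp.mapDomain_single, mapDomain_rt_thetaG, rt_oflipCM, huΦ, hu₁, huc] at hw
  have hd := Submodule.sub_mem _ hw hv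
  have e1 : oflipCM c hc2 h Φ = oflipCM c hc2 (c * h) Φ := (oflipCM_cmul c hc2 h Φ).symm
  have e2 : oflipCM c hc2 (h * u⁻¹) Φ = oflipCM c hc2 (c * (h * u⁻¹)) Φ := (oflipCM_cmul c hc2 _ Φ).symm
  have hsr : ∀ X : CMF G c, Finsupp.single (rt c c X) (1 : ℤ) = pair c X - Finsupp.single X 1 := fun X => by
    rw [pair, add_sub_cancel_left]
  rw [e1, thetaG_typeSum_oflipCM_of_not_mem c hc2 T₁ Φ hch1 hchΦ, thetaG_typeSum_oflipCM_of_not_mem c hc2 (rt c c T₀) Φ hch0c hchΦ,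
    e2, thetaG_typeSum_oflipCM_of_not_mem c hc2 T₁ Φ hcη1 hcηΦ, thetaG_typeSum_oflipCM_of_not_mem c hc2 (rt c c T₀) Φ hcη0c hcηΦ] at hd
  simp only [oflipCM_cmul, oflipCM_rt_self c hc2 hcen, hsr] at hd
  have hpairs : pair c (oflipCM c hc2 h T₀) - pair c (oflipCM c hc2 (h * u⁻¹) T₀) ∈ L := Submodule.sub_mem _ (hP _) (hP _)
  have h2 := Submodule.add_mem _ hpairs hd
  have e : ((Finsupp.single (oflipCM c hc2 h T₀) (1 : ℤ) - Finsupp.single T₀ 1) + (Finsupp.single (oflipCM c hc2 h T₁) (1 : ℤ) - Finsupp.single T₁ 1)) - ((Finsupp.single (oflipCM c hc2 (h * u⁻¹) T₀) (1 : ℤ) - Finsupp.single T₀ 1) + (Finsupp.single (oflipCM c hc2 (h * u⁻¹) T₁) (1 : ℤ) - Finsupp.single T₁ 1)) =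
      (pair c (oflipCM c hc2 h T₀) - pair c (oflipCM c hc2 (h * u⁻¹) T₀)) +
      ((Finsupp.single Φ 1 - thetaG c hc2 T₁ (typeSum G c (Finsupp.single Φ 1)) -
          (thetaG c hc2 (rt c c T₀) (typeSum G c (Finsupp.single Φ 1)) -
              (pair c (oflipCM c hc2 (h * u⁻¹) T₀) - Finsupp.single (oflipCM c hc2 (h * u⁻¹) T₀) 1 - (pair c T₀ - Finsupp.single T₀ 1)) -
            (thetaG c hc2 T₁ (typeSum G c (Finsupp.single Φ 1)) - (Finsupp.single (oflipCM c hc2 (h * u⁻¹) T₁) 1 - Finsupp.single T₁ 1)))) -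
        (Finsupp.single Φ 1 - thetaG c hc2 T₁ (typeSum G c (Finsupp.single Φ 1)) -
          (thetaG c hc2 (rt c c T₀) (typeSum G c (Finsupp.single Φ 1)) -
              (pair c (oflipCM c hc2 h T₀) - Finsupp.single (oflipCM c hc2 h T₀) 1 - (pair c T₀ - Finsupp.single T₀ 1)) -
            (thetaG c hc2 T₁ (typeSum G c (Finsupp.single Φ 1)) - (Finsupp.single (oflipCM c hc2 h T₁) 1 - Finsupp.single T₁ 1))))) := by
    abel
  rw [e]
  exact h2

include hLrt in
/-- **`Y'_{h·g₁⁻¹·u⁻¹} − Y_h ∈ L`**: the `u`-translate of `W = Y_h − Y'_{h·g₁⁻¹}` is `Y_{h·u⁻¹} − Y'_{h·g₁⁻¹·u⁻¹}` (kernel mover: `Y·u⁻¹ = Y`, `Y'·u⁻¹ = Y'`),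
and `Y_{h·u⁻¹} ≡ Y_h`. [folklore] -/
theorem Y'_sub_Y_mem_of_kernel_mover (g₁ h u : G) (hu₀ : rt c u T₀ = T₀) (hu₁ : rt c u T₁ = T₁)
    (hW : ((Finsupp.single (oflipCM c hc2 h T₀) (1 : ℤ) - Finsupp.single T₀ 1) + (Finsupp.single (oflipCM c hc2 h T₁) (1 : ℤ) - Finsupp.single T₁ 1)) - ((Finsupp.single (oflipCM c hc2 (h * g₁⁻¹) T₀) (1 : ℤ) - Finsupp.single T₀ 1) - (Finsupp.single (oflipCM c hc2 (h * g₁⁻¹) T₁) (1 : ℤ) - Finsupp.single T₁ 1)) ∈ L) (hU : ((Finsupp.single (oflipCM c hc2 h T₀) (1 : ℤ) - Finsupp.single T₀ 1) + (Finsupp.single (oflipCM c hc2 h T₁) (1 : ℤ) - Finsupp.single T₁ 1)) - ((Finsupp.single (oflipCM c hc2 (h * u⁻¹) T₀) (1 : ℤ) - Finsupp.single T₀ 1) + (Finsupp.single (oflipCM c hc2 (h * u⁻¹) T₁) (1 : ℤ) - Finsupp.single T₁ 1)) ∈ L) :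
    ((Finsupp.single (oflipCM c hc2 (h * g₁⁻¹ * u⁻¹) T₀) (1 : ℤ) - Finsupp.single T₀ 1) - (Finsupp.single (oflipCM c hc2 (h * g₁⁻¹ * u⁻¹) T₁) (1 : ℤ) - Finsupp.single T₁ 1)) - ((Finsupp.single (oflipCM c hc2 h T₀) (1 : ℤ) - Finsupp.single T₀ 1) + (Finsupp.single (oflipCM c hc2 h T₁) (1 : ℤ) - Finsupp.single T₁ 1)) ∈ L := by
  have ht := hLrt u _ hW
  rw [Finsupp.mapDomain_sub, mapDomain_rt_Y_of_stab_stab c hc2 T₀ T₁ u hu₀ hu₁, mapDomain_rt_Y'_of_stab_stab c hc2 T₀ T₁ u hu₀ hu₁] at ht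
  have h2 := Submodule.add_mem _ hU ht
  have e : ((Finsupp.single (oflipCM c hc2 (h * g₁⁻¹ * u⁻¹) T₀) (1 : ℤ) - Finsupp.single T₀ 1) - (Finsupp.single (oflipCM c hc2 (h * g₁⁻¹ * u⁻¹) T₁) (1 : ℤ) - Finsupp.single T₁ 1)) - ((Finsupp.single (oflipCM c hc2 h T₀) (1 : ℤ) - Finsupp.single T₀ 1) + (Finsupp.single (oflipCM c hc2 h T₁) (1 : ℤ) - Finsupp.single T₁ 1)) = -((((Finsupp.single (oflipCM c hc2 h T₀) (1 : ℤ) - Finsupp.single T₀ 1) + (Finsupp.single (oflipCM c hc2 h T₁) (1 : ℤ) - Finsupp.single T₁ 1)) - ((Finsupp.single (oflipCM c hc2 (h * u⁻¹) T₀) (1 : ℤ) - Finsupp.single T₀ 1) + (Finsupp.single (oflipCM c hc2 (h * u⁻¹) T₁) (1 : ℤ) - Finsupp.single T₁ 1))) + (((Finsupp.single (oflipCM c hc2 (h * u⁻¹) T₀) (1 : ℤ) - Finsupp.single T₀ 1) + (Finsupp.single (oflipCM c hc2 (h * u⁻¹) T₁) (1 : ℤ) - Finsupp.single T₁ 1))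 - ((Finsupp.single (oflipCM c hc2 (h * g₁⁻¹ * u⁻¹) T₀) (1 : ℤ) - Finsupp.single T₀ 1) - (Finsupp.single (oflipCM c hc2 (h * g₁⁻¹ * u⁻¹) T₁) (1 : ℤ) - Finsupp.single T₁ 1)))) := by
    abel
  rw [e]
  exact Submodule.neg_mem _ h2

/-! ## §3 The four families of fibre congruences -/

variable (hQ₁ : rt c Q T₁ = T₀)
variable (hσH : ∀ t ∈ T₀.1, ∀ t' ∈ T₀.1, (t' = t * Q ∨ t' = c * (t * Q)) → (t ∈ T₀.1 \ T₁.1 ↔ t' ∈ T₀.1 \ T₁.1))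

include hcen hbase hn hH hQ hQ₁ hσH hLrt hcover hP in
/-- **THE FIBRE CONGRUENCES.**  In the situation of part XLI (`Φ = {T ∣ A}`, mixed face at `k, h`, the two prescribed tie faces, `g₁ ∈ Stab T₀ ∩ Stab Φ`
with `T₁·g₁⁻¹ = T̄₁`), with `T`, `A` transversals of the base-involutive swap `Q`: if every `x ∈ 𝓗 ∖ T` is `h·u⁻¹` and every `y ∈ 𝓗ᶜ ∖ A` is
`h·g₁⁻¹·u⁻¹` for kernel movers `u` (`T₀·u⁻¹ = T₀`, `T₁·u⁻¹ = T₁`, `Φ·u⁻¹ = Φ`), then with `v = h·Q⁻¹`: `Y_x − Y_v ∈ L` (`x ∈ T`), `Y'_y + Y_v ∈ L`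
(`y ∈ A`), `Y_x − Y_h ∈ L` (`x ∈ 𝓗 ∖ T`), `Y'_y − Y_h ∈ L` (`y ∈ 𝓗ᶜ ∖ A`). [folklore] -/
theorem fibre_congruences (hm : 2 ≤ m) (T A : Finset G) (hTH : T ⊆ T₀.1 \ T₁.1) (hTm : T.card = m)
    (hA : A ⊆ T₀.1 ∩ T₁.1) (hAm : A.card = m)
    (hT : ∀ t ∈ T₀.1 \ T₁.1, ∀ t' ∈ T₀.1, (t' = t * Q ∨ t' = c * (t * Q)) → (t ∈ T ↔ t' ∉ T))
    (hAtr : ∀ t ∈ T₀.1 ∩ T₁.1, ∀ t' ∈ T₀.1, (t' = t * Q ∨ t' = c * (t * Q)) → (t ∈ A ↔ t' ∉ A))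
    (Φ : CMF G c) (hΦ : T₀.1 \ Φ.1 = T ∪ A)
    {k h : G} (hk : k ∈ A) (hh : h ∈ (T₀.1 \ T₁.1) \ T) (hF : gface c hc2 Φ k h ∈ L)
    {h₁ h₂ : G} (hh₁ : h₁ ∈ (T₀.1 \ T₁.1) \ T) (hh₂ : h₂ ∈ (T₀.1 \ T₁.1) \ T) (h₁₂ : h₁ ≠ h₂)
    (hFk : gface c hc2 (oflipCM c hc2 k Φ) h₁ h₂ ∈ L)
    {k₁ k₂ : G} (hk₁ : k₁ ∈ (T₀.1 ∩ T₁.1) \ A) (hk₂ : k₂ ∈ (T₀.1 ∩ T₁.1) \ A) (hk₁₂ : k₁ ≠ k₂)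
    (hFh : gface c hc2 (oflipCM c hc2 h Φ) k₁ k₂ ∈ L)
    (g₁ : G) (hg₀ : rt c g₁ T₀ = T₀) (hg₁ : rt c g₁ T₁ = rt c c T₁) (hgΦ : rt c g₁ Φ = Φ)
    (hTex : ∀ x ∈ (T₀.1 \ T₁.1) \ T, ∃ u : G, rt c u T₀ = T₀ ∧ rt c u T₁ = T₁ ∧ rt c u Φ = Φ ∧ x = h * u⁻¹)
    (hAex : ∀ y ∈ (T₀.1 ∩ T₁.1) \ A, ∃ u : G, rt c u T₀ = T₀ ∧ rt c u T₁ = T₁ ∧ rt c u Φ = Φ ∧ y = h * g₁⁻¹ * u⁻¹) :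
    (∀ x ∈ T, ((Finsupp.single (oflipCM c hc2 x T₀) (1 : ℤ) - Finsupp.single T₀ 1) + (Finsupp.single (oflipCM c hc2 x T₁) (1 : ℤ) - Finsupp.single T₁ 1)) - ((Finsupp.single (oflipCM c hc2 (h * Q⁻¹) T₀) (1 : ℤ) - Finsupp.single T₀ 1) + (Finsupp.single (oflipCM c hc2 (h * Q⁻¹) T₁) (1 : ℤ) - Finsupp.single T₁ 1)) ∈ L) ∧
    (∀ y ∈ A, ((Finsupp.single (oflipCM c hc2 y T₀) (1 : ℤ) - Finsupp.single T₀ 1) - (Finsupp.single (oflipCM c hc2 y T₁) (1 : ℤ) - Finsupp.single T₁ 1)) + ((Finsupp.single (oflipCM c hc2 (h * Q⁻¹) T₀) (1 : ℤ) - Finsupp.single T₀ 1) + (Finsupp.single (oflipCM c hc2 (h * Q⁻¹) T₁) (1 : ℤ) - Finsupp.single T₁ 1)) ∈ L) ∧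
    (∀ x ∈ (T₀.1 \ T₁.1) \ T, ((Finsupp.single (oflipCM c hc2 x T₀) (1 : ℤ) - Finsupp.single T₀ 1) + (Finsupp.single (oflipCM c hc2 x T₁) (1 : ℤ) - Finsupp.single T₁ 1)) - ((Finsupp.single (oflipCM c hc2 h T₀) (1 : ℤ) - Finsupp.single T₀ 1) + (Finsupp.single (oflipCM c hc2 h T₁) (1 : ℤ) - Finsupp.single T₁ 1)) ∈ L) ∧
    (∀ y ∈ (T₀.1 ∩ T₁.1) \ A, ((Finsupp.single (oflipCM c hc2 y T₀) (1 : ℤ) - Finsupp.single T₀ 1) - (Finsupp.single (oflipCM c hc2 y T₁) (1 : ℤ) - Finsupp.single T₁ 1)) - ((Finsupp.single (oflipCM c hc2 h T₀) (1 : ℤ) - Finsupp.single T₀ 1) + (Finsupp.single (oflipCM c hc2 h T₁) (1 : ℤ) - Finsupp.single T₁ 1)) ∈ L) := by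
  have hW := Y_sub_Y'_mem_of_mixed_face' c hc2 hcen T₀ T₁ hbase m hn hH Q hQ L hLrt hcover hP hm T A hTH hTm hA hAm Φ hΦ hk hh hF hh₁ hh₂ h₁₂
    hFk hk₁ hk₂ hk₁₂ hFh g₁ hg₀ hg₁ hgΦ
  -- the `U`-congruences along the fibres `𝓗 ∖ T` and `𝓗ᶜ ∖ A`
  have hUT : ∀ x ∈ (T₀.1 \ T₁.1) \ T, ((Finsupp.single (oflipCM c hc2 x T₀) (1 : ℤ) - Finsupp.single T₀ 1) + (Finsupp.single (oflipCM c hc2 x T₁) (1 : ℤ) - Finsupp.single T₁ 1)) - ((Finsupp.single (oflipCM c hc2 h T₀) (1 : ℤ) - Finsupp.single T₀ 1) + (Finsupp.single (oflipCM c hc2 h T₁) (1 : ℤ) - Finsupp.single T₁ 1)) ∈ L := by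
    intro x hx
    obtain ⟨u, hu₀, hu₁, huΦ, rfl⟩ := hTex x hx
    have e := Submodule.neg_mem _ (Y_sub_Y_mem_of_kernel_mover c hc2 hcen T₀ T₁ hbase m hn hH Q hQ L hLrt hcover hP hm T A hTH hTm hA hAm Φ hΦ
      hk hh hF hh₁ hh₂ h₁₂ hFk hk₁ hk₂ hk₁₂ hFh u hu₀ hu₁ huΦ)
    rwa [neg_sub] at e
  have hUA : ∀ y ∈ (T₀.1 ∩ T₁.1) \ A, ((Finsupp.single (oflipCM c hc2 y T₀) (1 : ℤ) - Finsupp.single T₀ 1) - (Finsupp.single (oflipCM c hc2 y T₁) (1 : ℤ) - Finsupp.single T₁ 1)) - ((Finsupp.single (oflipCM c hc2 h T₀) (1 : ℤ) - Finsupp.single T₀ 1) + (Finsupp.single (oflipCM c hc2 h T₁) (1 : ℤ) - Finsupp.single T₁ 1)) ∈ L := by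
    intro y hy
    obtain ⟨u, hu₀, hu₁, huΦ, rfl⟩ := hAex y hy
    exact Y'_sub_Y_mem_of_kernel_mover c hc2 T₀ T₁ L hLrt g₁ h u hu₀ hu₁ hW
      (Y_sub_Y_mem_of_kernel_mover c hc2 hcen T₀ T₁ hbase m hn hH Q hQ L hLrt hcover hP hm T A hTH hTm hA hAm Φ hΦ hk hh hF hh₁ hh₂ h₁₂ hFk
        hk₁ hk₂ hk₁₂ hFh u hu₀ hu₁ huΦ)
  refine ⟨fun x hx => ?_, fun y hy => ?_, hUT, hUA⟩
  · -- `x ∈ T`: its `Q`-neighbour `x'` lies in `𝓗 ∖ T` and `x ∼ x'·Q⁻¹`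
    have hxH : x ∈ T₀.1 \ T₁.1 := hTH hx
    have hx0 : x ∈ T₀.1 := (mem_sdiff.mp hxH).1
    obtain ⟨x', hx'0, hrel⟩ : ∃ x' : G, x' ∈ T₀.1 ∧ (x' = x * Q ∨ x' = c * (x * Q)) := by
      by_cases hq : x * Q ∈ T₀.1
      · exact ⟨x * Q, hq, Or.inl rfl⟩
      · exact ⟨c * (x * Q), by by_contra h'; exact hq ((T₀.2 _).mpr h'), Or.inr rfl⟩
    have hx'H : x' ∈ T₀.1 \ T₁.1 := (hσH x hx0 x' hx'0 hrel).mp hxH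
    have hx'T : x' ∉ T := (hT x hxH x' hx'0 hrel).mp hx
    have hx' : x' ∈ (T₀.1 \ T₁.1) \ T := mem_sdiff.mpr ⟨hx'H, hx'T⟩
    have ht := hLrt Q _ (hUT x' hx')
    rw [Finsupp.mapDomain_sub, mapDomain_rt_Y_of_swap c hc2 T₀ T₁ Q hQ hQ₁, mapDomain_rt_Y_of_swap c hc2 T₀ T₁ Q hQ hQ₁] at ht
    have ex : oflipCM c hc2 (x' * Q⁻¹) T₀ = oflipCM c hc2 x T₀ ∧ oflipCM c hc2 (x' * Q⁻¹) T₁ = oflipCM c hc2 x T₁ := by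
      rcases hrel with rfl | rfl
      · rw [mul_inv_cancel_right]; exact ⟨rfl, rfl⟩
      · rw [mul_assoc, mul_inv_cancel_right, oflipCM_cmul, oflipCM_cmul]; exact ⟨rfl, rfl⟩
    rw [ex.1, ex.2] at ht
    exact ht
  · -- `y ∈ A`: its `Q`-neighbour `y'` lies in `𝓗ᶜ ∖ A`
    have hyI : y ∈ T₀.1 ∩ T₁.1 := hA hy
    have hy0 : y ∈ T₀.1 := (mem_inter.mp hyI).1
    obtain ⟨y', hy'0, hrel⟩ : ∃ y' : G, y' ∈ T₀.1 ∧ (y' = y * Q ∨ y' = c * (y * Q)) := by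
      by_cases hq : y * Q ∈ T₀.1
      · exact ⟨y * Q, hq, Or.inl rfl⟩
      · exact ⟨c * (y * Q), by by_contra h'; exact hq ((T₀.2 _).mpr h'), Or.inr rfl⟩
    have hyH : y ∉ T₀.1 \ T₁.1 := fun h' => (mem_sdiff.mp h').2 (mem_inter.mp hyI).2
    have hy'H : y' ∉ T₀.1 \ T₁.1 := fun h' => hyH ((hσH y hy0 y' hy'0 hrel).mpr h')
    have hy'I : y' ∈ T₀.1 ∩ T₁.1 := mem_inter.mpr ⟨hy'0, by by_contra h'; exact hy'H (mem_sdiff.mpr ⟨hy'0, h'⟩)⟩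
    have hy'A : y' ∉ A := (hAtr y hyI y' hy'0 hrel).mp hy
    have hy' : y' ∈ (T₀.1 ∩ T₁.1) \ A := mem_sdiff.mpr ⟨hy'I, hy'A⟩
    have ht := hLrt Q _ (hUA y' hy')
    rw [Finsupp.mapDomain_sub, mapDomain_rt_Y'_of_swap c hc2 T₀ T₁ Q hQ hQ₁, mapDomain_rt_Y_of_swap c hc2 T₀ T₁ Q hQ hQ₁] at ht
    have ey : oflipCM c hc2 (y' * Q⁻¹) T₀ = oflipCM c hc2 y T₀ ∧ oflipCM c hc2 (y' * Q⁻¹) T₁ = oflipCM c hc2 y T₁ := by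
      rcases hrel with rfl | rfl
      · rw [mul_inv_cancel_right]; exact ⟨rfl, rfl⟩
      · rw [mul_assoc, mul_inv_cancel_right, oflipCM_cmul, oflipCM_cmul]; exact ⟨rfl, rfl⟩
    rw [ey.1, ey.2] at ht
    have e := Submodule.neg_mem _ ht
    have e2 : -(-((Finsupp.single (oflipCM c hc2 y T₀) (1 : ℤ) - Finsupp.single T₀ 1) -
          (Finsupp.single (oflipCM c hc2 y T₁) (1 : ℤ) - Finsupp.single T₁ 1)) -
        ((Finsupp.single (oflipCM c hc2 (h * Q⁻¹) T₀) (1 : ℤ) - Finsupp.single T₀ 1) +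
          (Finsupp.single (oflipCM c hc2 (h * Q⁻¹) T₁) (1 : ℤ) - Finsupp.single T₁ 1))) =
        ((Finsupp.single (oflipCM c hc2 y T₀) (1 : ℤ) - Finsupp.single T₀ 1) -
          (Finsupp.single (oflipCM c hc2 y T₁) (1 : ℤ) - Finsupp.single T₁ 1)) +
        ((Finsupp.single (oflipCM c hc2 (h * Q⁻¹) T₀) (1 : ℤ) - Finsupp.single T₀ 1) +
          (Finsupp.single (oflipCM c hc2 (h * Q⁻¹) T₁) (1 : ℤ) - Finsupp.single T₁ 1)) := by
      abel
    rw [e2] at e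
    exact e

end Frame

end

end Summit.HodgeConjecture.CorCM.Census.CentralSquares
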